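import Summits.AnomalousDissipation.AnomalousDissipation.Theorems.SawtoothPulseCascadeApproxPieces
import Summits.AnomalousDissipation.AnomalousDissipation.Theorems.SawtoothPulseCascadeK3LocalisedClosureExistenceAssembly
import Literature.Analysis.FunctionSpaces.TorusLinearisedNSExistence

/-!
# Assembly at a fixed admissible viscosity: realigned data, pieces, and the phase envelope
(route `AnomalousDissipation/SawtoothPulseCascade`; helper for the crux ApproxSol58 =
stmt-AnomalousDissipation-19688, registered stub `stub_responseL2` / S1 `stub_responseL2Envelope`:
the realignment pipeline, assembly)

For a parameter point `P` (`δ₀ > 0`, `d > 0`, `γ ≥ 0`, `N_j ≠ 0`), a viscosity `ν > 0` satisfying the budget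
`16π²ν N_j² tHalf_j ≤ δ_j²` for the phases `j ≤ J`, and the K2″ property at `ν` with constant `C`, every
classical forced linearised response `(L, q)` on `[0, T'] ⊇ [0, tStart (J+1)]` from zero obeys, on slot `k`
(phase `k/2 ≤ J`):
`√∫‖L(t)‖² ≤ Σ_{i<k} (C e^{σ⋆γ})^{k/2+1−i/2} · 12√π ν γ N_{i/2}/δ_{i/2} + 6√(2π) ν γ N_{k/2}/δ_{k/2}`.
The realigned comb profiles come from `exists_realigned_H/V` (`…ApproxRealign`), the pieces from the tree's
`Torus.linearisedNS_exists` (zero-mean comb data), the envelope from `response_phase_envelope`.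
-/

set_option linter.dupNamespace false

noncomputable section

namespace Summit.AnomalousDissipation.AnomalousDissipation.Theorems.SawtoothPulseCascade.ApproxResponse

open Set MeasureTheory UnitAddTorus
open scoped ContDiff InnerProductSpace
open Literature.Analysis Literature.Analysis.FunctionSpaces Literature.Analysis.FluidPDE
open Literature.Analysis.FluidPDE.SawtoothCascade
open Literature.Analysis.FluidPDE.SawtoothCascade.CascadeParams
open Summit.AnomalousDissipation.AnomalousDissipation.Theorems.SawtoothPulseCascade.K2Classical

/-- Under the (non-strict, halved) budget `16π²νN²τ ≤ δ²` with `ν, τ > 0`: the strict budget holds and the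
sharper width is at least `δ/√2`, so `1/δ' ≤ √2/δ`. -/
theorem budget_facts {δ ν τ : ℝ} {N : ℕ} (hδ : 0 < δ) (hν : 0 < ν) (hτ : 0 < τ) (hN : N ≠ 0)
    (hbud : 16 * Real.pi ^ 2 * ν * (N : ℝ) ^ 2 * τ ≤ δ ^ 2) :
    8 * Real.pi ^ 2 * ν * (N : ℝ) ^ 2 * τ < δ ^ 2 ∧
      1 / Real.sqrt (δ ^ 2 - 8 * Real.pi ^ 2 * ν * (N : ℝ) ^ 2 * τ) ≤ Real.sqrt 2 / δ := by
  have hN' : (0 : ℝ) < N := Nat.cast_pos.2 (Nat.pos_of_ne_zero hN)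
  have hpos : 0 < 8 * Real.pi ^ 2 * ν * (N : ℝ) ^ 2 * τ := by positivity
  refine ⟨by linarith, ?_⟩
  have hge : δ ^ 2 / 2 ≤ δ ^ 2 - 8 * Real.pi ^ 2 * ν * (N : ℝ) ^ 2 * τ := by linarith
  have hs : δ / Real.sqrt 2 ≤ Real.sqrt (δ ^ 2 - 8 * Real.pi ^ 2 * ν * (N : ℝ) ^ 2 * τ) := by
    rw [Real.le_sqrt (by positivity) (by linarith), div_pow, Real.sq_sqrt (by norm_num : (0 : ℝ) ≤ 2)]
    exact hge
  have h2 : (0 : ℝ) < Real.sqrt 2 := Real.sqrt_pos.2 (by norm_num)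
  have hd : 0 < δ / Real.sqrt 2 := by positivity
  calc 1 / Real.sqrt (δ ^ 2 - 8 * Real.pi ^ 2 * ν * (N : ℝ) ^ 2 * τ) ≤ 1 / (δ / Real.sqrt 2) :=
        one_div_le_one_div_of_le hd hs
    _ = Real.sqrt 2 / δ := by field_simp

section Assembly

variable (P : CascadeParams) {ν C T' : ℝ} {J : ℕ}

/-- **The phase envelope at an admissible viscosity.**  See the module docstring. -/
theorem response_envelope_of_budget (hδ₀ : 0 < P.δ₀) (hd : 0 < P.d) (hγ : 0 ≤ P.γ) (hN : ∀ j, P.N j ≠ 0)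
    (hν : 0 < ν) (hC : 0 ≤ C)
    (hK2ν : ∀ (j₀ J : ℕ), j₀ ≤ J → ∀ (hz : Bool)
      (w₀ : UnitAddTorus (Fin 2) → EuclideanSpace ℝ (Fin 2))
      (w : ℝ → UnitAddTorus (Fin 2) → EuclideanSpace ℝ (Fin 2)) (q : ℝ → UnitAddTorus (Fin 2) → ℝ),
      ShearCombDatum (P.N j₀) hz w₀ →
      Torus.IsSmoothSpaceTimeOn (Icc (CascadeParams.tInject j₀ hz) (CascadeParams.tStart (J + 1))) w →
      Torus.IsSmoothSpaceTimeOn (Icc (CascadeParams.tInject j₀ hz) (CascadeParams.tStart (J + 1))) q →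
      (∀ t ∈ Icc (CascadeParams.tInject j₀ hz) (CascadeParams.tStart (J + 1)), Torus.IsDivFree (w t)) →
      (∀ t ∈ Icc (CascadeParams.tInject j₀ hz) (CascadeParams.tStart (J + 1)), ∀ x,
        Torus.timeDerivWithin (Icc (CascadeParams.tInject j₀ hz) (CascadeParams.tStart (J + 1))) w t x +
          Torus.convect (P.field t) (w t) x + Torus.convect (w t) (P.field t) x =
          ν • Torus.laplacian (w t) x - Torus.gradient (q t) x) →
      w (CascadeParams.tInject j₀ hz) = w₀ →
      ∀ t ∈ Icc (max (CascadeParams.tInject j₀ hz) (CascadeParams.tStart J)) (CascadeParams.tStart (J + 1)),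
        Torus.vectorL2Sq (w t) ≤ (C * Real.exp (sawSigmaStar * P.γ)) ^ (2 * (J + 1 - j₀)) * Torus.vectorL2Sq w₀)
    (hbud : ∀ j ≤ J, 16 * Real.pi ^ 2 * ν * (P.N j : ℝ) ^ 2 * tHalf j ≤ P.δ j ^ 2)
    (hJT : tStart (J + 1) ≤ T') (hT'1 : T' < 1)
    {L : ℝ → UnitAddTorus (Fin 2) → EuclideanSpace ℝ (Fin 2)} {q : ℝ → UnitAddTorus (Fin 2) → ℝ}
    (hL : Torus.IsSmoothSpaceTimeOn (Icc 0 T') L) (hq : Torus.IsSmoothSpaceTimeOn (Icc 0 T') q)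
    (hLdiv : ∀ t ∈ Icc 0 T', Torus.IsDivFree (L t)) (hL0 : L 0 = fun _ => 0)
    (hlin : ∀ t ∈ Icc 0 T', ∀ x, Torus.timeDerivWithin (Icc 0 T') L t x + Torus.convect (P.field t) (L t) x +
      Torus.convect (L t) (P.field t) x =
        ν • Torus.laplacian (L t) x - Torus.gradient (q t) x + ν • Torus.laplacian (P.field t) x)
    {k : ℕ} (hk : k < 2 * (J + 1)) {t : ℝ}
    (ht : t ∈ Icc (CascadeParams.tInject (k / 2) (k % 2 == 0)) (CascadeParams.tInject ((k + 1) / 2) ((k + 1) % 2 == 0))) :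
    Real.sqrt (Torus.vectorL2Sq (L t)) ≤
      ∑ i ∈ Finset.range k, (C * Real.exp (sawSigmaStar * P.γ)) ^ (k / 2 + 1 - i / 2) *
          (12 * Real.sqrt Real.pi * ν * P.γ * (P.N (i / 2)) / P.δ (i / 2)) +
        6 * Real.sqrt (2 * Real.pi) * ν * (P.N (k / 2)) * P.γ / P.δ (k / 2) := by
  have hδ : ∀ j, 0 < P.δ j := fun j => P.δ_pos hδ₀ hd j
  have hbud' : ∀ j ≤ J, 8 * Real.pi ^ 2 * ν * (P.N j : ℝ) ^ 2 * tHalf j < P.δ j ^ 2 :=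
    fun j hj => (budget_facts (hδ j) hν (tHalf_pos j) (hN j) (hbud j hj)).1
  -- Step 1: the realigned comb profiles, phase by phase (H and V)
  have hexH : ∀ j : ℕ, ∃ g : ℝ → ℝ, j ≤ J → (ContDiff ℝ ∞ g ∧ Function.Periodic g 1 ∧
      (∀ m : ℤ, (¬ ∃ n : ℤ, m = (2 * n + 1) * (P.N j : ℤ)) →
        fourierCoeff (AddCircle.liftIco 1 0 fun y => (g y : ℂ)) m = 0) ∧
      (∀ y, |g y| ≤ 6 * Real.sqrt (2 * Real.pi) * ν * (P.N j) * P.γ /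
        Real.sqrt (P.δ j ^ 2 - 8 * Real.pi ^ 2 * ν * (P.N j : ℝ) ^ 2 * tHalf j)) ∧
      (∀ c F : ℝ → ℝ → ℝ,
        ContDiffOn ℝ ∞ (Function.uncurry c) (Icc (tStart j) (tStart j + tHalf j) ×ˢ univ) →
        (∀ t ∈ Icc (tStart j) (tStart j + tHalf j), Function.Periodic (c t) 1) →
        (∀ t ∈ Icc (tStart j) (tStart j + tHalf j), ∀ y,
          derivWithin (fun s => c s y) (Icc (tStart j) (tStart j + tHalf j)) t = ν * deriv (deriv (c t)) y) →
        c (tStart j) = g →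
        ContDiffOn ℝ ∞ (Function.uncurry F) (Icc (tStart j) (tStart j + tHalf j) ×ˢ univ) →
        (∀ t ∈ Icc (tStart j) (tStart j + tHalf j), Function.Periodic (F t) 1) → F (tStart j) = (fun _ => 0) →
        (∀ t ∈ Icc (tStart j) (tStart j + tHalf j), ∀ y,
          derivWithin (fun s => F s y) (Icc (tStart j) (tStart j + tHalf j)) t =
            ν * deriv (deriv (F t)) y + ν * (P.rateH j t * deriv (deriv (P.U j)) y)) →
        c (tStart j + tHalf j) = F (tStart j + tHalf j))) := by
    intro j
    by_cases hj : j ≤ J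
    · obtain ⟨g, h1, h2, h3, h4, h5⟩ := exists_realigned_H P hδ₀ hd hγ (hN j) hν (hbud' j hj)
      exact ⟨g, fun _ => ⟨h1, h2, h3, h4, h5⟩⟩
    · exact ⟨fun _ => 0, fun h => absurd h hj⟩
  have hexV : ∀ j : ℕ, ∃ g : ℝ → ℝ, j ≤ J → (ContDiff ℝ ∞ g ∧ Function.Periodic g 1 ∧
      (∀ m : ℤ, (¬ ∃ n : ℤ, m = (2 * n + 1) * (P.N j : ℤ)) →
        fourierCoeff (AddCircle.liftIco 1 0 fun y => (g y : ℂ)) m = 0) ∧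
      (∀ y, |g y| ≤ 6 * Real.sqrt (2 * Real.pi) * ν * (P.N j) * P.γ /
        Real.sqrt (P.δ j ^ 2 - 8 * Real.pi ^ 2 * ν * (P.N j : ℝ) ^ 2 * tHalf j)) ∧
      (∀ c F : ℝ → ℝ → ℝ,
        ContDiffOn ℝ ∞ (Function.uncurry c) (Icc (tStart j + tHalf j) (tStart (j + 1)) ×ˢ univ) →
        (∀ t ∈ Icc (tStart j + tHalf j) (tStart (j + 1)), Function.Periodic (c t) 1) →
        (∀ t ∈ Icc (tStart j + tHalf j) (tStart (j + 1)), ∀ y,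
          derivWithin (fun s => c s y) (Icc (tStart j + tHalf j) (tStart (j + 1))) t = ν * deriv (deriv (c t)) y) →
        c (tStart j + tHalf j) = g →
        ContDiffOn ℝ ∞ (Function.uncurry F) (Icc (tStart j + tHalf j) (tStart (j + 1)) ×ˢ univ) →
        (∀ t ∈ Icc (tStart j + tHalf j) (tStart (j + 1)), Function.Periodic (F t) 1) →
        F (tStart j + tHalf j) = (fun _ => 0) →
        (∀ t ∈ Icc (tStart j + tHalf j) (tStart (j + 1)), ∀ y,
          derivWithin (fun s => F s y) (Icc (tStart j + tHalf j) (tStart (j + 1))) t =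
            ν * deriv (deriv (F t)) y + ν * (P.rateV j t * deriv (deriv (P.U j)) y)) →
        c (tStart (j + 1)) = F (tStart (j + 1)))) := by
    intro j
    by_cases hj : j ≤ J
    · obtain ⟨g, h1, h2, h3, h4, h5⟩ := exists_realigned_V P hδ₀ hd hγ (hN j) hν (hbud' j hj)
      exact ⟨g, fun _ => ⟨h1, h2, h3, h4, h5⟩⟩
    · exact ⟨fun _ => 0, fun h => absurd h hj⟩
  choose gH hgH using hexH
  choose gV hgV using hexV
  -- the slot-indexed profiles and sizes
  set g : ℕ → ℝ → ℝ := fun k => if k % 2 = 0 then gH (k / 2) else gV (k / 2) with hg_def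
  set G : ℕ → ℝ := fun k => 6 * Real.sqrt (2 * Real.pi) * ν * (P.N (k / 2)) * P.γ /
    Real.sqrt (P.δ (k / 2) ^ 2 - 8 * Real.pi ^ 2 * ν * (P.N (k / 2) : ℝ) ^ 2 * tHalf (k / 2)) with hG_def
  have hg_even : ∀ j, g (2 * j) = gH j := fun j => by
    simp only [hg_def, Nat.mul_mod_right, ↓reduceIte, show 2 * j / 2 = j by omega]
  have hg_odd : ∀ j, g (2 * j + 1) = gV j := fun j => by
    simp only [hg_def, show (2 * j + 1) % 2 = 1 by omega, one_ne_zero, ↓reduceIte, show (2 * j + 1) / 2 = j by omega]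
  have hkJ : ∀ {k : ℕ}, k < 2 * (J + 1) → k / 2 ≤ J := fun hk => by omega
  -- properties of `g k` for `k < 2(J+1)`
  have hgk : ∀ k < 2 * (J + 1), ContDiff ℝ ∞ (g k) ∧ Function.Periodic (g k) 1 ∧
      (∀ m : ℤ, (¬ ∃ n : ℤ, m = (2 * n + 1) * (P.N (k / 2) : ℤ)) →
        fourierCoeff (AddCircle.liftIco 1 0 fun y => (g k y : ℂ)) m = 0) ∧
      (∀ y, |g k y| ≤ G k) := by
    intro k hk
    obtain ⟨j, rfl | rfl⟩ := Nat.even_or_odd' k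
    · obtain ⟨h1, h2, h3, h4, -⟩ := hgH j (by omega)
      rw [hg_even]
      refine ⟨h1, h2, by simpa [show 2 * j / 2 = j by omega] using h3, fun y => ?_⟩
      simp only [hG_def, show 2 * j / 2 = j by omega]
      exact h4 y
    · obtain ⟨h1, h2, h3, h4, -⟩ := hgV j (by omega)
      rw [hg_odd]
      refine ⟨h1, h2, by simpa [show (2 * j + 1) / 2 = j by omega] using h3, fun y => ?_⟩
      simp only [hG_def, show (2 * j + 1) / 2 = j by omega]
      exact h4 y
  have hG0 : ∀ k, 0 ≤ G k := fun k => by simp only [hG_def]; positivity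
  -- Step 2: the pieces `W k` (classical homogeneous solutions on `[σ k, T']` from the comb data)
  have hfield : Torus.IsSmoothSpaceTimeOn (Ico 0 1) P.field := cascadeFieldSmooth P hδ₀ hd
  have hexW : ∀ k : ℕ, ∃ (W : ℝ → UnitAddTorus (Fin 2) → EuclideanSpace ℝ (Fin 2)) (R : ℝ → UnitAddTorus (Fin 2) → ℝ),
      k < 2 * (J + 1) →
      (Torus.IsSmoothSpaceTimeOn (Icc (CascadeParams.tInject (k / 2) (k % 2 == 0)) T') W ∧
       Torus.IsSmoothSpaceTimeOn (Icc (CascadeParams.tInject (k / 2) (k % 2 == 0)) T') R ∧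
       (∀ t ∈ Icc (CascadeParams.tInject (k / 2) (k % 2 == 0)) T', Torus.IsDivFree (W t)) ∧
       (∀ t ∈ Icc (CascadeParams.tInject (k / 2) (k % 2 == 0)) T', ∀ x,
          Torus.timeDerivWithin (Icc (CascadeParams.tInject (k / 2) (k % 2 == 0)) T') W t x +
            Torus.convect (P.field t) (W t) x + Torus.convect (W t) (P.field t) x =
              ν • Torus.laplacian (W t) x - Torus.gradient (R t) x) ∧
       W (CascadeParams.tInject (k / 2) (k % 2 == 0)) =
         (if k % 2 = 0 then fun x => g k (Torus.repr x 1) • EuclideanSpace.single (0 : Fin 2) (1 : ℝ)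
          else fun x => g k (Torus.repr x 0) • EuclideanSpace.single (1 : Fin 2) (1 : ℝ))) := by
    intro k
    by_cases hk : k < 2 * (J + 1)
    · have hab : CascadeParams.tInject (k / 2) (k % 2 == 0) < T' := by
        have h1 : CascadeParams.tInject (k / 2) (k % 2 == 0) < CascadeParams.tInject ((k + 1) / 2) ((k + 1) % 2 == 0) :=
          slotStart_lt_succ k
        have h2 : CascadeParams.tInject ((k + 1) / 2) ((k + 1) % 2 == 0) ≤ tStart (J + 1) := by
          rw [← slotStart_even (J + 1)]; exact slotStart_mono (by omega)
        linarith
      have hI : Icc (CascadeParams.tInject (k / 2) (k % 2 == 0)) T' ⊆ Ico (0 : ℝ) 1 := fun s hs =>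
        ⟨(slotStart_nonneg k).trans hs.1, hs.2.trans_lt hT'1⟩
      have hu := hfield.mono hI
      have hudiv : ∀ s ∈ Icc (CascadeParams.tInject (k / 2) (k % 2 == 0)) T', Torus.IsDivFree (P.field s) :=
        fun s hs => DriftFreeExistence.isDivFree_field P (hI hs)
      obtain ⟨h1, h2, h3, -⟩ := hgk k hk
      by_cases hpar : k % 2 = 0
      · obtain ⟨W, R, hW, hR, hWdiv, -, -, hWlin, hW0⟩ :=
          Torus.linearisedNS_exists hν hab hu hudiv (isSmooth_parallelShear (k := 1) (m := 0) h2 h1)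
            (isDivFree_parallelShear (k := 1) (m := 0) (by decide) h2) (hasZeroMean_comb_H (hN _) h1 h2 h3)
        exact ⟨W, R, fun _ => ⟨hW, hR, hWdiv, hWlin, by rw [if_pos hpar]; exact hW0⟩⟩
      · obtain ⟨W, R, hW, hR, hWdiv, -, -, hWlin, hW0⟩ :=
          Torus.linearisedNS_exists hν hab hu hudiv (isSmooth_parallelShear (k := 0) (m := 1) h2 h1)
            (isDivFree_parallelShear (k := 0) (m := 1) (by decide) h2) (hasZeroMean_comb_V (hN _) h1 h2 h3)
        exact ⟨W, R, fun _ => ⟨hW, hR, hWdiv, hWlin, by rw [if_neg hpar]; exact hW0⟩⟩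
    · exact ⟨fun _ _ => 0, fun _ _ => 0, fun h => absurd h hk⟩
  choose W R hWR using hexW
  -- Step 3: the envelope
  have hW0H : ∀ j, 2 * j < 2 * (J + 1) → W (2 * j) (tStart j) =
      fun x => g (2 * j) (Torus.repr x 1) • EuclideanSpace.single (0 : Fin 2) (1 : ℝ) := by
    intro j hj
    have h := (hWR (2 * j) hj).2.2.2.2
    rw [slotStart_even, if_pos (Nat.mul_mod_right 2 j)] at h
    exact h
  have hW0V : ∀ j, 2 * j + 1 < 2 * (J + 1) → W (2 * j + 1) (tStart j + tHalf j) =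
      fun x => g (2 * j + 1) (Torus.repr x 0) • EuclideanSpace.single (1 : Fin 2) (1 : ℝ) := by
    intro j hj
    have h := (hWR (2 * j + 1) hj).2.2.2.2
    rw [slotStart_odd, if_neg (by omega : ¬ (2 * j + 1) % 2 = 0)] at h
    exact h
  have henv := response_phase_envelope P (W := W) (g := g) (G := G) hδ₀ hd hγ hN hν hC hK2ν hJT hL hq hLdiv hL0 hlin
    (fun k hk => ⟨(hgk k hk).1, (hgk k hk).2.1⟩) (fun k hk => (hgk k hk).2.2.1) hG0 (fun k hk => (hgk k hk).2.2.2)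
    (fun j hj => by rw [hg_even]; exact (hgH j (by omega)).2.2.2.2)
    (fun j hj => by rw [hg_odd]; exact (hgV j (by omega)).2.2.2.2)
    (R := R) (fun i hi => (hWR i hi).1) (fun i hi => (hWR i hi).2.1) (fun i hi => (hWR i hi).2.2.1)
    (fun i hi => (hWR i hi).2.2.2.1) hW0H hW0V hk ht
  refine henv.trans (add_le_add (Finset.sum_le_sum fun i hi => ?_) le_rfl)
  have hi' : i < 2 * (J + 1) := (Finset.mem_range.1 hi).trans hk
  have hE : 0 ≤ (C * Real.exp (sawSigmaStar * P.γ)) ^ (k / 2 + 1 - i / 2) :=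
    pow_nonneg (mul_nonneg hC (Real.exp_pos _).le) _
  refine mul_le_mul_of_nonneg_left ?_ hE
  -- `G i ≤ 12 √π ν γ N/δ` from `1/δ' ≤ √2/δ`
  have hfac := (budget_facts (hδ (i / 2)) hν (tHalf_pos (i / 2)) (hN (i / 2)) (hbud (i / 2) (hkJ hi'))).2
  have hN' : (0 : ℝ) ≤ (P.N (i / 2) : ℝ) := Nat.cast_nonneg _
  have hnum : 0 ≤ 6 * Real.sqrt (2 * Real.pi) * ν * (P.N (i / 2) : ℝ) * P.γ := by positivity
  simp only [hG_def]
  calc 6 * Real.sqrt (2 * Real.pi) * ν * (P.N (i / 2) : ℝ) * P.γ /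
        Real.sqrt (P.δ (i / 2) ^ 2 - 8 * Real.pi ^ 2 * ν * (P.N (i / 2) : ℝ) ^ 2 * tHalf (i / 2))
      = 6 * Real.sqrt (2 * Real.pi) * ν * (P.N (i / 2) : ℝ) * P.γ *
          (1 / Real.sqrt (P.δ (i / 2) ^ 2 - 8 * Real.pi ^ 2 * ν * (P.N (i / 2) : ℝ) ^ 2 * tHalf (i / 2))) := by
        ring
    _ ≤ 6 * Real.sqrt (2 * Real.pi) * ν * (P.N (i / 2) : ℝ) * P.γ * (Real.sqrt 2 / P.δ (i / 2)) :=
        mul_le_mul_of_nonneg_left hfac hnum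
    _ = 6 * (Real.sqrt 2 * Real.sqrt 2) * Real.sqrt Real.pi * ν * (P.N (i / 2) : ℝ) * P.γ / P.δ (i / 2) := by
        rw [Real.sqrt_mul (by norm_num : (0 : ℝ) ≤ 2)]
        ring
    _ = 12 * Real.sqrt Real.pi * ν * P.γ * (P.N (i / 2) : ℝ) / P.δ (i / 2) := by
        rw [Real.mul_self_sqrt (by norm_num : (0 : ℝ) ≤ 2)]
        ring

end Assembly

end Summit.AnomalousDissipation.AnomalousDissipation.Theorems.SawtoothPulseCascade.ApproxResponse

end
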